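import Summits.PneNP.GCT.Max.DetKYLeadingTermsTwoCount
import HarnessLib
import HarnessLib.Audit

/-!
# `GCT/Max`: a kernel-cheap form of the inclusion–exclusion evaluation `lt2IE` (cell `pub-gct-max`, track F; theory-2 memo `FINDINGS-LT2.md` §3)

`Max/DetKYLeadingTermsTwoCount.lean` proves `lt2Count = lt2IE` and the certificate interface `LT2Certificate`
(`b ≤ lt2IE n p k σ ⇒ b ≤ rank KY_{p,k}(det_n)`).  Kernel evaluation of `lt2IE` (`decide +kernel`) costs ≈ 20 s per cell at `n = 4` and
does not fit the default per-declaration budget at `n = 6`; the two avoidable costs are the recursive `Nat.choose` (unary recursion, millions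
of steps at `C(35, 8)`) and the `vpos.symm` / filtered-`univ` membership tests inside `allowed`.  This module gives the SAME sum in a cheap form:

* `allowedP` — the allowed set filtered on `Fin n × Fin n` with the block test unfolded to `r ∈ I' ∖ {w.1} ∨ c ∈ J' ∖ {w.2}`;
  `allowed = map vpos (allowedP)` (`allowed_eq_map`), so `|allowedP| = a_C` (`card_allowedP`);
* `lt2IEFast` — the triple sum with `allowedP` and the binomial as `descFactorial / factorial`; `lt2IEFast = lt2IE` (`lt2IEFast_eq`);
* `le_kyRank_detPoly_of_le_lt2IEFast` and the PACKAGED (PROVED) interface `LT2FastCertificate`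
  (`b ≤ lt2IEFast n p k σ ⇒ b ≤ rank KY_{p,k}(det_n)` over `ℂ`).

Measured: the `n = 4` cell `p = 8` drops from ≈ 19 s to ≈ 5 s; an `n = 6`, `k = 1` cell (3 375 terms) costs ≈ 120 s and is evaluated row by
row (fifteen declarations of ≈ 8 s) in `Max/KYCannotSeparatePaddedPerFourFromSix.lean`, the first user.

HONEST FRAMING: an evaluation device for the cell's own bound `LT2` (one flattening family's METHOD-CEILING statements); no mathematics beyond
`Max/DetKYLeadingTermsTwoCount`; nothing here bears on dc(per_m), VP vs VNP or P vs NP. Theory-2 gen 27. [folklore]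
-/

open Finset

namespace Summit.PneNP.GCT

open Literature.Computability.AlgebraicComplexity Literature.Barriers.ValiantsHypothesis

namespace DetKYLeadingTermsTwo

open DetKYLeadingTerms (vpos)

section Fast

variable (n : ℕ) (σ : Equiv.Perm (Fin (n * n))) (I' J' : Finset (Fin n))

/-- FAST form of `allowed`: the same set read in matrix coordinates `(r, c)` (no `vpos.symm`), with the block condition unfolded to
`r ∈ I' \ {w.1} ∨ c ∈ J' \ {w.2}` (no filtered-`univ` membership). Kernel-evaluation device; equal in cardinality to `allowed`
(`card_allowedP`). [folklore] -/
def allowedP (C : Finset (Fin n × Fin n)) : Finset (Fin n × Fin n) :=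
  univ.filter fun rc => ∀ w ∈ C, rc ≠ w ∧ (σ (vpos n w) < σ (vpos n rc) → rc.1 ∈ I'.erase w.1 ∨ rc.2 ∈ J'.erase w.2)

/-- `allowed` is the image of `allowedP` under `vpos`. [folklore] -/
theorem allowed_eq_map (C : Finset (Fin n × Fin n)) :
    allowed n σ I' J' C = (allowedP n σ I' J' C).map (vpos n).toEmbedding := by
  ext q
  simp only [allowed, allowedP, block, mem_filter, mem_univ, true_and, mem_map_equiv, Equiv.apply_symm_apply]
  refine forall₂_congr fun w _ => and_congr ?_ Iff.rfl
  rw [ne_eq, ne_eq, Equiv.symm_apply_eq]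

/-- `|allowedP| = aCount`. [folklore] -/
theorem card_allowedP (C : Finset (Fin n × Fin n)) : (allowedP n σ I' J' C).card = aCount n σ I' J' C := by
  rw [aCount, allowed_eq_map, card_map]

/-- FAST form of the inclusion–exclusion evaluation `lt2IE`: the same triple sum with `allowedP` for `allowed` and the binomial
computed as `descFactorial / factorial` (the recursive `Nat.choose` dominates kernel time otherwise). [folklore] -/
def lt2IEFast (n p k : ℕ) (σ : Equiv.Perm (Fin (n * n))) : ℤ :=
  ∑ I' ∈ (univ : Finset (Fin n)).powersetCard (k + 1), ∑ J' ∈ (univ : Finset (Fin n)).powersetCard (k + 1),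
    ∑ C ∈ (I' ×ˢ J').powerset.filter (·.Nonempty),
      (-1 : ℤ) ^ (C.card + 1) *
        (((allowedP n σ I' J' C).card.descFactorial (n * n - (p + 1)) / (n * n - (p + 1)).factorial : ℕ) : ℤ)

/-- `lt2IEFast = lt2IE` (`card_allowedP` and `Nat.choose_eq_descFactorial_div_factorial`). [folklore] -/
theorem lt2IEFast_eq (n p k : ℕ) (σ : Equiv.Perm (Fin (n * n))) : lt2IEFast n p k σ = lt2IE n p k σ := by
  unfold lt2IEFast lt2IE
  simp_rw [← Nat.choose_eq_descFactorial_div_factorial, card_allowedP]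

/-- Certificate interface on the fast form: `b ≤ lt2IEFast n p k σ ⇒ b ≤ rank KY_{p,k}(det_n)` (any field). [folklore] -/
theorem le_kyRank_detPoly_of_le_lt2IEFast (K : Type*) [Field K] {n p k : ℕ} {σ : Equiv.Perm (Fin (n * n))}
    (hp : p + 1 ≤ n * n) (b : ℕ) (hb : (b : ℤ) ≤ lt2IEFast n p k σ) : b ≤ kyRank K p k (detPoly (Fin n) K) := by
  rw [lt2IEFast_eq] at hb
  exact le_kyRank_detPoly_of_le_lt2IE K hp b hb

end Fast

end DetKYLeadingTermsTwo

/-- `GCT/Max` support **LT2FastCertificate** — the certificate interface on the FAST evaluation: for all `n p k b σ` with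
`p + 1 ≤ n²`, `b ≤ lt2IEFast n p k σ ⇒ b ≤ rank KY_{p,k}(det_n)` over `ℂ`; cell tables discharge the premise by `decide +kernel`.
A statement of the cell, PROVED below. [folklore] -/
def LT2FastCertificate : Prop :=
  ∀ (n p k b : ℕ) (σ : Equiv.Perm (Fin (n * n))), p + 1 ≤ n * n →
    (b : ℤ) ≤ DetKYLeadingTermsTwo.lt2IEFast n p k σ → b ≤ kyRank ℂ p k (detPoly (Fin n) ℂ)

/-- `LT2FastCertificate` holds. [folklore] -/
theorem lt2FastCertificate_holds : LT2FastCertificate :=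
  fun _ _ _ b _ hp hb => DetKYLeadingTermsTwo.le_kyRank_detPoly_of_le_lt2IEFast ℂ hp b hb

end Summit.PneNP.GCT
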